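/-
HODGE LADDER — STAGE 4, row 1 (K3 surfaces: products and powers): the printed link "square ⟹ all powers"
between the targets `HC_K3Pairs` and `HC_K3Powers` of `CorCM/Stage4Interfaces.lean` holds in print ONLY for
K3 surfaces whose endomorphism field `E = End_Hdg T(S)` is a CM field (Ramón Marí 2008 Prop. 3.1, CM branch
= Varesco 2025 Thm. 2.2 / §2.3); kernel-typed modulo ONE named fact, with its consequences: all powers of K3
surfaces with complex multiplication (Ramón Marí 2008 Thm. 3.3 = Varesco 2025 Cor. 2.3, via Buskin 2019 /
Huybrechts 2019) and — with the de Cataldo–Migliorini record of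
`Literature/AlgebraicGeometry/HodgeTheory/DominatedByPowersHodgeConjecture` and the DISCHARGED Arapura step of
`CorCM/Stage4StrictRoadDischargePowers` — their Hilbert schemes of points and all their powers.
v2 (literature seat hodge-director-lit-stage4, gen 8, 2026-08-21): ERRATUM — v1 (gen 4, p246533) took the
record `Surfaces.RamonMari2008_hodgeClasses_algebraic_K3Powers_of_square` (Prop. 3.1 AS PRINTED, for every
projective K3 surface) as hypothesis of all five theorems; that statement is NOT a theorem in print for a
totally real endomorphism field (Varesco 2025, Michigan Math. J. 75, Thm. 2.16 / Rem. 2.17: the exceptional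
Hodge classes `⋀ʳ_E T(S) ⊂ H^{2r}(S^r, ℚ)`, `r = dim_E T(S)`, are not generated by the Hodge classes of `S × S`).
v3 (operator maintenance A35, 2026-08-21): the five v1 theorems (`hc_K3Powers_succ_of_hc_K3Pairs`,
`hc_K3Powers_succ_of_square`, `hc_K3Powers_succ_of_CM`, `hc_K3HilbertScheme_of_CM`, `hc_K3HilbertScheme_of_hc_K3Pairs`),
deprecated in v2, are REMOVED together with the v1 Literature record; the `_of_hasCM` theorems below, which take the
CM-restricted record `Surfaces.RamonMari2008_hodgeClasses_algebraic_K3Powers_of_square_of_CM` (Literature file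
v2, p250516), are the file's content; the three general-K3 statements have NO replacement without the CM hypothesis
(HOME STAGE4-ABELIAN-MOTIVIC-TYPE.md v8 §10).  Sibling of `CorCM/Stage4Interfaces.lean`, `CorCM/Stage4RowOneKugaSatake.lean`,
`CorCM/Stage4RowOneInstances.lean`, `CorCM/Stage4StrictAbelianType.lean`, `CorCM/Stage4StrictRoadDischargePowers.lean`.
Companion document run/shared/lean/pub/hodge-director/STAGE4-ABELIAN-MOTIVIC-TYPE.md (v8).  Theorems only;
nothing asserted beyond the named facts taken as hypotheses.
-/
import Summits.HodgeConjecture.CorCM.Stage4Interfaces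
import Summits.HodgeConjecture.CorCM.Stage4StrictRoadDischargePowers
import Literature.AlgebraicGeometry.Surfaces.K3PowersHodgeOfSquare
import Literature.AlgebraicGeometry.HodgeTheory.DominatedByPowersHodgeConjecture
import HarnessLib

/-!
# Stage 4, row 1, CM sub-row: `HC_K3Pairs ⟹` all positive powers of a K3 surface WITH COMPLEX MULTIPLICATION (Ramón Marí 2008 Prop. 3.1, CM case = Varesco 2025 Thm. 2.2); all powers of CM K3 surfaces (Thm. 3.3 = Cor. 2.3); Hilbert schemes of CM K3 surfaces and their powers

Live theorems (v2):
* `hc_K3Powers_succ_of_square_of_hasCM` — for ONE projective K3 surface `S` with complex multiplication, the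
  Hodge conjecture for the square `S × S` gives it for every positive power `S^{m+1}`, modulo the record
  `Surfaces.RamonMari2008_hodgeClasses_algebraic_K3Powers_of_square_of_CM` (invariant theory of
  `Hg(T(S))_ℂ ≅ ∏_σ GL`: first fundamental theorem for the general linear group).
* `hc_K3Powers_succ_of_hc_K3Pairs_of_hasCM` — the target `HC_K3Pairs` (in fact only the squares) implies the
  Hodge conjecture for every positive power of every CM K3 surface, modulo the same record.
* `hc_K3Powers_succ_of_hasCM` — **all positive powers of a K3 surface with complex multiplication** (Ramón Marí
  Thm. 3.3 = Varesco Cor. 2.3), modulo the CM-case Prop. 3.1 and the CM-square record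
  `Surfaces.Buskin2019_hodgeConjectureFor_square_of_CM` (Buskin 2019 Corollary / Huybrechts 2019 Cor. 0.4 (ii)).
* `hc_K3HilbertScheme_of_hasCM` — **the Hodge conjecture for the Hilbert schemes `S^{[n]}` of K3 surfaces with
  complex multiplication and all their powers**, UNCONDITIONAL modulo THREE CITE records of printed theorems
  (CM-case Prop. 3.1; Buskin/Huybrechts CM square; de Cataldo–Migliorini 2002 Thm. 6.2.1) — the fourth input of
  v1, Arapura 2006 Lemma 4.2, is now the kernel theorem
  `Arapura2006_hodgeClasses_algebraic_of_isDominatedByPowers_holds` (`CorCM/Stage4StrictRoadDischargePowers`).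
* `hc_K3HilbertScheme_of_hc_K3Pairs_of_hasCM` — `HC_K3Pairs ⟹` HC for all `S^{[n]}` of CM K3 surfaces and their
  powers, modulo two records.

Removed in v3 (were deprecated in v2): `hc_K3Powers_succ_of_hc_K3Pairs`, `hc_K3Powers_succ_of_square`,
`hc_K3HilbertScheme_of_hc_K3Pairs` (general K3 surfaces: their hypothesis record is not a theorem in print for
totally real `E`), `hc_K3Powers_succ_of_CM`, `hc_K3HilbertScheme_of_CM` (superseded by the `_of_hasCM` forms).

What is NOT here (and is not a theorem in print): "square ⟹ all powers" for a K3 surface with TOTALLY REAL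
endomorphism field.  By Varesco 2025 Thm. 2.16 the Hodge classes on the powers of such an `S` are generated by
those of degree two AND the exceptional classes in degree `2 dim_E T(S)`; in print the exceptional classes are
reached only through an ALGEBRAIC Kuga–Satake correspondence plus the Hodge conjecture for the powers of the
Kuga–Satake variety (Varesco 2025 Thm. 4.3 for the Picard-16 families; this tree's road (R2)
`hc_K3Powers_of_KSH_betti_of_floccari`, file `CorCM/Stage4RowOneKugaSatake`) or under Grothendieck's `B` for all
smooth projective varieties (road (R1) `hc_K3Powers_of_B_of_andre`, file `CorCM/Stage4RoadR1AbelianTypePieces`).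
-/

noncomputable section

open CategoryTheory MonoidalCategory
open Literature.AlgebraicGeometry
open Literature.AlgebraicGeometry.Motives (SchemeOver IsSmoothProjective)
open Literature.AlgebraicGeometry.HodgeTheory
open Literature.AlgebraicGeometry.HilbertScheme (IsHilbertSchemeOfPoints)
open Literature.AlgebraicGeometry.Surfaces (IsK3Surface HasComplexMultiplication
  RamonMari2008_hodgeClasses_algebraic_K3Powers_of_square_of_CM
  Buskin2019_hodgeConjectureFor_square_of_CM)

namespace Summit.HodgeConjecture.CorCM.Stage4

variable {S H : SchemeOver ℂ} {n : ℕ} {Ξ : (S ⊗ H).left.IdealSheafData}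

/-! ### v2: the CM sub-row, routed through the CM-restricted record (p250516) -/

/-- Per-surface form, CM case: the Hodge conjecture for the square `S × S` of ONE projective K3 surface with
complex multiplication gives it for all positive powers of `S`, modulo the record.
[cite: RamonMari2008, Prop. 3.1 (CM case)] [cite: Varesco2025, Thm. 2.2 and §2.3] -/
theorem hc_K3Powers_succ_of_square_of_hasCM (h31 : RamonMari2008_hodgeClasses_algebraic_K3Powers_of_square_of_CM)
    (hS : IsK3Surface S) (hCM : HasComplexMultiplication S) (hsq : HodgeConjectureFor 4 (S ⊗ S)) (m : ℕ) :
    HodgeConjectureFor ((m + 1) * 2) (S.pow (m + 1)) :=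
  h31 hS hCM hsq m

/-- **`HC_K3Pairs ⟹` the Hodge conjecture for every positive cartesian power `S^{m+1}` of every projective K3
surface WITH COMPLEX MULTIPLICATION** (the CM case of Ramón Marí 2008 Prop. 3.1 applied to the square `S ⊗ S`),
modulo the record.  (For a totally real endomorphism field no such implication is in print: module docstring.)
[cite: RamonMari2008, Prop. 3.1 (CM case)] [cite: Varesco2025, Thm. 2.2, §2.3 and Rem. 2.17] -/
theorem hc_K3Powers_succ_of_hc_K3Pairs_of_hasCM (h31 : RamonMari2008_hodgeClasses_algebraic_K3Powers_of_square_of_CM)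
    (h : HC_K3Pairs) (hS : IsK3Surface S) (hCM : HasComplexMultiplication S) (m : ℕ) :
    HodgeConjectureFor ((m + 1) * 2) (S.pow (m + 1)) :=
  h31 hS hCM (h hS hS) m

/-- **Ramón Marí 2008 Thm. 3.3 = Varesco 2025 Cor. 2.3 in kernel form: the Hodge conjecture for all positive
powers of a projective K3 surface with complex multiplication**, modulo the CM-case Prop. 3.1 and the CM-square
record (Buskin 2019 Corollary / Huybrechts 2019 Cor. 0.4 (ii)).
[cite: RamonMari2008, Thm. 3.3] [cite: Varesco2025, Cor. 2.3] [cite: Huybrechts2019, Cor. 0.4 (ii)] -/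
theorem hc_K3Powers_succ_of_hasCM (h31 : RamonMari2008_hodgeClasses_algebraic_K3Powers_of_square_of_CM)
    (hB : Buskin2019_hodgeConjectureFor_square_of_CM) (hS : IsK3Surface S) (hCM : HasComplexMultiplication S)
    (m : ℕ) : HodgeConjectureFor ((m + 1) * 2) (S.pow (m + 1)) :=
  RamonMari2008_hodgeClasses_algebraic_K3Powers_of_square_of_CM.hodgeConjectureFor_pow_of_CM h31 hB hS hCM m

/-- **The Hodge conjecture for the Hilbert schemes `S^{[n]}` of projective K3 surfaces with complex
multiplication, and all their powers — UNCONDITIONAL modulo three CITE records** (CM-case Prop. 3.1;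
Buskin/Huybrechts CM square; de Cataldo–Migliorini 2002 Thm. 6.2.1), the Arapura 2006 Lemma 4.2 step being the
kernel theorem `Arapura2006_hodgeClasses_algebraic_of_isDominatedByPowers_holds`.  Instances: the singular K3
surfaces (`ρ = 20`), whose `T(S)_ℚ` is a CM structure by an imaginary quadratic field.
[cite: RamonMari2008, Thm. 3.3] [cite: Varesco2025, Cor. 2.3] [cite: Arapura2006, Lemma 4.2 and Thm. 7.4]
[cite: DecataldoMigliorini2002, Thm. 6.2.1] -/
theorem hc_K3HilbertScheme_of_hasCM (h31 : RamonMari2008_hodgeClasses_algebraic_K3Powers_of_square_of_CM)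
    (hB : Buskin2019_hodgeConjectureFor_square_of_CM)
    (h74 : DecataldoMigliorini2002_hilbertScheme_isDominatedByPowers) (hS : IsK3Surface S)
    (hCM : HasComplexMultiplication S) (hH : IsHilbertSchemeOfPoints n S H Ξ) (hHs : IsSmoothProjective (2 * n) H) :
    HodgeConjectureFor (2 * n) H ∧ ∀ m : ℕ, HodgeConjectureFor ((m + 1) * (2 * n)) (H.pow (m + 1)) :=
  Arapura2006_hodgeClasses_algebraic_of_isDominatedByPowers.hodgeConjectureFor_hilbertScheme_of_surfacePowers
    Arapura2006_hodgeClasses_algebraic_of_isDominatedByPowers_holds h74 hS.isSmoothProjective hH hHs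
    (hc_K3Powers_succ_of_hasCM h31 hB hS hCM)

/-- `HC_K3Pairs ⟹` the Hodge conjecture for every Hilbert scheme `S^{[n]}` of a projective K3 surface with
complex multiplication and all its powers (CM-case Prop. 3.1, then de Cataldo–Migliorini / Arapura, the latter
discharged), modulo two records. [cite: RamonMari2008, Prop. 3.1 (CM case)] [cite: Varesco2025, Thm. 2.2]
[cite: Arapura2006, Lemma 4.2 and Thm. 7.4] [cite: DecataldoMigliorini2002, Thm. 6.2.1] -/
theorem hc_K3HilbertScheme_of_hc_K3Pairs_of_hasCM
    (h31 : RamonMari2008_hodgeClasses_algebraic_K3Powers_of_square_of_CM)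
    (h74 : DecataldoMigliorini2002_hilbertScheme_isDominatedByPowers) (h : HC_K3Pairs) (hS : IsK3Surface S)
    (hCM : HasComplexMultiplication S) (hH : IsHilbertSchemeOfPoints n S H Ξ) (hHs : IsSmoothProjective (2 * n) H) :
    HodgeConjectureFor (2 * n) H ∧ ∀ m : ℕ, HodgeConjectureFor ((m + 1) * (2 * n)) (H.pow (m + 1)) :=
  Arapura2006_hodgeClasses_algebraic_of_isDominatedByPowers.hodgeConjectureFor_hilbertScheme_of_surfacePowers
    Arapura2006_hodgeClasses_algebraic_of_isDominatedByPowers_holds h74 hS.isSmoothProjective hH hHs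
    (hc_K3Powers_succ_of_hc_K3Pairs_of_hasCM h31 h hS hCM)

end Summit.HodgeConjecture.CorCM.Stage4

end
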